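import Literature.MathematicalPhysics.QuantumFieldTheory.Balaban1983to89.B9SectBCodedFamiliesUParH

/-!
# `Balaban1983to89.B9SectBL2StepUParH` — T. Bałaban, *Propagators for lattice gauge theories in a background field*, Commun. Math. Phys. **99** (1985) 389–434
# [Balaban1985BackgroundPropagators], Thm 3.4 p. 400 with (3.46) p. 398 and p. 398 (first remark after Thm 3.1): THE (3.46) MEMBER OF THE SECT.-B STEP FOR THE
# TWO-TRANSPORTER CODED READING `KSCUPar parA parH` (pub-ymgap N06 [B9]; CASCADE-K step K1, the (C) road, module F1b)

statement-level skeleton of published theorems with citation tags; proofs where landed; nothing here is a claim about the Yang–Mills mass gap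

THE PRINT.  (3.46) p. 398: the six `L²` quantities of `G′(U)` with a cut-off `h`; p. 398 first remark: the (3.46)-bounds with two differences follow from the
others and the plaquette size ((3.35)); Sect. B transports (3.46) from `U` to `U′U` (p. 402 after (3.64), p. 403 l. 1–9).  The `L²` members do not read any
parallel transporter of the Hölder quotients.

WHY THIS FILE (pub-ymgap node N06 [B9]; director-ym №383 CASCADE-K, K1 := this seat's lineage; module F1b of the (C) road I.19389).  The tree's (3.46) member of the
Sect.-B step of record is `B9SectBStepsKSCUBlocks(R).stepL2Pos_KSCU_on`: the `L²` frame over the `L²`-augmented family `B9SectBL2DictionaryY(R).KSC₃ par` plus the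
input transport `hin_KSCU₃_on_pos`.  For the two-transporter reading `KSCUPar parA parH` the input transport must land in a family carrying `KSCUPar`'s Hölder
members (cf. `B9SectBCodedFamiliesUParH`), so THIS FILE re-keys the `L²` frame family:
* §1 ★ `KSC₃Par P G x parA parH := { KSC₃ parA with h1, e4, h2 := (KSCUPar parA parH).… }` + members ∕ bridges (`eBlock ∕ l2Block_KSC₃Par_iff`), the (3.42)
  dictionaries (`read342Y ∕ write342Y_KSC₃Par` = `KSC₃ parA`'s), the nonnegativity of `KSCUPar`'s Hölder members at a base (`KSCUPar_holder_nonneg_base`);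
* §2 ★★ `thms_KSC₃Par_base_of_KSCUPar` — at a regular base, the block of `(KSCUPar, KACU, C)` gives that of `(KSC₃Par, KACU, C)`: the (3.42)∕(3.47) members
  through `B9SectBCodedFamiliesUParH.thms_KSC₇Par_base_of_KSCUPar`, the augmented (3.46) member by `B9SectBL2SecondOrderY(R).l2Block_KSC₃_base_of_record` AT `parA`
  under the plaquette law, the Hölder members BY IDENTITY at `parH` (rate `min δ₀ (δ₀∕2)`: antitone by nonnegativity); ★★ `hin_KSCUPar₃_on_pos`;
* §3 ★ `l2Frame₂CodedOnPar` (the `L²` frame AT `KSC₃Par`: dag-n06-c g9's `l2Frame₂CodedOn` with the root frame at `parA` and the `L²` dictionaries of `KSC₃ parA`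
  bridged), ★ `stepL2nPos_KSC₃Par_on` ∕ ★ `stepL2Pos_KSC₃Par_on` (g9's member-by-member assembly, verbatim at the re-keyed family);
* §4 `houtL2_KSCUPar_on` (`l2Block_KSCU_of_KSC₃` at `parA`), ★★★ `stepL2Pos_KSCUPar_on` — THE (3.46) MEMBER OF THE SECT.-B STEP OF RECORD FOR `(KSCUPar parA parH, KACU, C⁻¹)`
  (binders = `stepL2Pos_KSCU_on`'s with `par ↦ parA`: root-frame laws `hpar hunit hC37` at `parA`, `hcL`, the plaquette law `hplaq`; NO law of `parH`).

HONEST SCOPE ∕ NOT CLAIMED.  Bookkeeping over landed frames and one transport estimate assembled from landed lemmas; nothing of [B9]'s analysis re-proved; displayed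
laws are hypotheses; count-neutral; N06 NOT discharged; nothing continuum ∕ OS ∕ mass gap ∕ Clay.  NEW file; no `sorry`, no `axiom`, no `instance`, no `notation`; two
`def`s (the family `KSC₃Par`, the frame instance).  Cell `pub-ymgap` (D-0062), seat `pub-ymgap-dag-n06-c` (gen 24), 2026-08-30; `--supports stmt-QuantumFields-27364`.
Net new unproved facts: 0.

RELATED IN THE TREE, NOT DUPLICATED (searched 2026-08-30: `rg 'KSC₃Par|l2Frame₂CodedOnPar|stepL2Pos_KSCUPar|hin_KSCUPar₃' lean/Literature lean/Summits` — 0 hits):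
`B9SectBL2DictionaryY(R)` (`KSC₃`, `l2Frame₂CodedOn`, `readL2_* ∕ writeL2_*_KSC₃` USED), `B9SectBL2StepCodedOn(R)` (`stepL2nPos_KSC₃_on` twinned), `B9SectBL2StepRecordOn(R)`
(`hin_KSC₃_on_explicit` — the single-transporter transport; its pieces `exists_thresholds_L2`, `l2Block_KSC₃_base_of_record` USED), `B9SectBStepsKSCUBlocks(R)`
(`l2Block_KSCU_of_KSC₃`, `KACU_holder_nonneg`, `stepL2Pos_KSCU_on` = the diagonal instance), `B9SectBCodedFamiliesUParH` (`KSC₇Par`, `thms_KSC₇Par_base_of_KSCUPar`, USED).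
-/

noncomputable section

namespace Literature.MathematicalPhysics.QuantumFieldTheory.Balaban1983to89.B9SectBL2StepUParH

open Literature.MathematicalPhysics.QuantumFieldTheory.Balaban1983to89.B9SectBCodedClassR (RegExtraY bg9YC)
open Literature.MathematicalPhysics.QuantumFieldTheory.Balaban1983to89.B9SectBCodedFamiliesUParH
open B6Ineq2142KLevelV1 (β)
open B6RandomWalk (Ineq261)
open B9Thm34Ext (toB6)
open B9Ineq347 (ScaleTransfer)
open B9FromB6 (EBlock L2Block GlobBlock)
open B9SectBCodedCarrier (CCfg Coding pullK pullS)
open B9Eq360DeltaPrimeAY (AfldY)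
open B9PinMembersKLevelV1 (MemberY geo9Y bg9Y)
open B9SectBGpLettersY (GVal decY)
open B9SectBGpFrameCodedYR (codingYx Read342Y Write342Y)
open B9SectBGpFrameCodedY (CplxLettersY)
open B9SectBGpReadingsYR (KSC read342Y_KSC write342Y_KSC)
open B9SectBGpReadingsY (baseY)
open B9SectBCodedReadingsUR (KSCU KACU)
open B9SectBCodedReadingsUParH (KSCUPar)
open B9SectBStepsKSCUR (KACU_members_base ineq342_346_347_congr KSCU_members_base)
open B9SectBStepsKSCUBlocksR (KACU_holder_nonneg l2Block_KSCU_of_KSC₃)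
open B9SectBGpTransferInYR (ineq343_345_congr ineq342_346_347_mono KSC_members_base pullK_members_base)
open B9SectBGpTransferOutYR (ineq342_346_347_weaken ineq343_345_antitone)
open B9SectBGpTransferOutY (kernelFamilyS_members_nonneg)
open B9SectBCodedChainGlobR (KSC₂)
open B9SectBL2DictionaryYR (KSC₃ read342Y_KSC₃ write342Y_KSC₃ readL2_KSC₃ readL2_two_KSC₃ readL2_three_KSC₃ readL2_four_KSC₃ readL2_five_KSC₃ writeL2_zero_KSC₃ writeL2_one_KSC₃
  writeL2_two_KSC₃ writeL2_three_KSC₃ writeL2_four_KSC₃ writeL2_five_KSC₃)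
open B9SectBL2SecondOrderYR (l2Block_KSC₃_base_of_record)
open B9SectBL2SecondOrderY (PlaqLawY cross2ConstL2 cross2ConstL2_nonneg)
open B9SectBL2TransferInY (crossConstL2 crossConstL2_nonneg)
open B9SectBCodedChainL2R (thms_mono_B₀)
open B9SectBCodedChainL2 (exists_thresholds_L2 l2Block_max_zero l2Block_weaken)
open B9SectBStepL2FamilyTransferPos (stepL2Pos_of_family_pos)
open B9SectBStepWhole (StepL2nPos StepL2Pos stepL2Pos_of_members)
open B9GeoNbrCountKLevelV1 (exists_card_nbr_geo9Y_le_of_M)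
open B9RWSumsReadsNbr (nbr)
open B9GeoNormsKLevelModelSignsV1 (modelSignsOn_geo9K)
open Node00 (SiteY BlkY IBondY CfgY SiteParY BondParY BondOpY deltaPrimeAY kernelFamilyS kernelFamilyB GpY)

variable {d ℓ : ℕ} {hd : 1 ≤ d + 1} {hL : Odd (ℓ + 1) ∧ 1 < ℓ + 1} {b₀ b₁ : ℝ} {Mstar : ℕ}
variable {𝔸 : Type} [NormedRing 𝔸] (P : RegExtraY d ℓ hd hL b₀ b₁ Mstar 𝔸) [NormedAlgebra ℂ 𝔸] [CompleteSpace 𝔸]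

/-! ## §1 The `L²` frame family `KSC₃Par parA parH` -/

section Family

variable (G : Subgroup 𝔸ˣ) (x : MemberY d ℓ hd hL b₀ b₁ Mstar) (parA parH par : SiteParY 𝔸 x.toKIdx) (OA : BondOpY 𝔸 x.toKIdx) (parB : BondParY 𝔸 x.toKIdx)
  (C37 C38 : ℝ → CfgY 𝔸 x.toKIdx → AfldY 𝔸 x.toKIdx → Prop)

/-- ★ **`KSC₃Par`** — the `L²` FRAME FAMILY of the two-transporter reading: dag-n06-c g9's `L²`-augmented coded reading `KSC₃ parA` ((3.42) augmented, (3.46) augmented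
by `l2AugS`, (3.47) silent at products) with the Hölder ∕ (3.44) members REPLACED by those of `KSCUPar parA parH`.
[cite: Balaban1985BackgroundPropagators, (3.42)–(3.47) pp.397–398, Thm 3.4 p.400, (3.40) p.397, p.403 l.1–9] -/
def KSC₃Par : B9.KernelFamily (geo9Y x) (codingYx P G x C37 C38).bg :=
  { KSC₃ P G x parA C37 C38 with
    h1 := (KSCUPar P G x parA parH C37 C38).h1, e4 := (KSCUPar P G x parA parH C37 C38).e4, h2 := (KSCUPar P G x parA parH C37 C38).h2 }

/-- the members of `KSC₃Par` (`rfl` ×6). [cite: Balaban1985BackgroundPropagators, (3.42)–(3.47) pp.397–398, bookkeeping] -/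
theorem KSC₃Par_members :
    (KSC₃Par P G x parA parH C37 C38).e = (KSC P G x parA C37 C38).e ∧ (KSC₃Par P G x parA parH C37 C38).h1 = (KSCUPar P G x parA parH C37 C38).h1 ∧
      (KSC₃Par P G x parA parH C37 C38).e4 = (KSCUPar P G x parA parH C37 C38).e4 ∧ (KSC₃Par P G x parA parH C37 C38).h2 = (KSCUPar P G x parA parH C37 C38).h2 ∧
      (KSC₃Par P G x parA parH C37 C38).l2 = (KSC₃ P G x parA C37 C38).l2 ∧ (KSC₃Par P G x parA parH C37 C38).glob = (KSC₂ P G x parA C37 C38).glob :=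
  ⟨rfl, rfl, rfl, rfl, rfl, rfl⟩

/-- the Hölder ∕ (3.44) members of `KSC₃Par` are those of `KSC₇Par` (both = `KSCUPar`'s), and so are its (3.42) members (`rfl` ×4).
[cite: Balaban1985BackgroundPropagators, (3.42)–(3.45) pp.397–398, bookkeeping] -/
theorem KSC₃Par_members₇ :
    (KSC₃Par P G x parA parH C37 C38).e = (KSC₇Par P G x parA parH C37 C38).e ∧ (KSC₃Par P G x parA parH C37 C38).h1 = (KSC₇Par P G x parA parH C37 C38).h1 ∧
      (KSC₃Par P G x parA parH C37 C38).e4 = (KSC₇Par P G x parA parH C37 C38).e4 ∧ (KSC₃Par P G x parA parH C37 C38).h2 = (KSC₇Par P G x parA parH C37 C38).h2 :=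
  ⟨rfl, rfl, rfl, rfl⟩

/-- the (3.42) block of `KSC₃Par` IS that of `KSC₃ parA` (= `KSC parA`'s). [cite: Balaban1985BackgroundPropagators, (3.42) p.397, bookkeeping] -/
theorem eBlock_KSC₃Par_iff {B₀ δ : ℝ} (c : (codingYx P G x C37 C38).bg.Cfg) :
    EBlock (KSC₃Par P G x parA parH C37 C38) B₀ δ c ↔ EBlock (KSC₃ P G x parA C37 C38) B₀ δ c := by
  rw [EBlock, EBlock, (KSC₃Par_members P G x parA parH C37 C38).1]; exact Iff.rfl

/-- the (3.46) block of `KSC₃Par` IS that of `KSC₃ parA`. [cite: Balaban1985BackgroundPropagators, (3.46) p.398, bookkeeping] -/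
theorem l2Block_KSC₃Par_iff {B₀ δ : ℝ} (c : (codingYx P G x C37 C38).bg.Cfg) :
    L2Block (KSC₃Par P G x parA parH C37 C38) B₀ δ c ↔ L2Block (KSC₃ P G x parA C37 C38) B₀ δ c := by
  rw [L2Block, L2Block, (KSC₃Par_members P G x parA parH C37 C38).2.2.2.2.1]

/-- the Hölder ∕ (3.44) members of the two-transporter reading `KSCUPar parA parH` at a base are NONNEGATIVE (they are def-Y's readings of `G′_{parA}(U)` with the
transporter `parH`: suprema of nonnegative quantities). [cite: Balaban1985BackgroundPropagators, (3.43)–(3.45) p.398, bookkeeping] -/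
theorem KSCUPar_holder_nonneg_base (U : CfgY 𝔸 x.toKIdx) :
    (∀ lam β' ζ, 0 ≤ (KSCUPar P G x parA parH C37 C38).h1 (.base U) lam β' ζ) ∧ (∀ lam y, 0 ≤ (KSCUPar P G x parA parH C37 C38).e4 (.base U) lam y) ∧
      (∀ lam β' ζ, 0 ≤ (KSCUPar P G x parA parH C37 C38).h2 (.base U) lam β' ζ) := by
  have hnn := kernelFamilyS_members_nonneg x parH (B := bg9YC 𝔸 G P x) (fun U => U) (GpY x.toKIdx parA) U
  have e1 : (KSCUPar P G x parA parH C37 C38).h1 (.base U) = (kernelFamilyS x.toKIdx (bg9YC 𝔸 G P x) (fun U => U) (GpY x.toKIdx parA) parH).h1 U := rfl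
  have e4 : (KSCUPar P G x parA parH C37 C38).e4 (.base U) = (kernelFamilyS x.toKIdx (bg9YC 𝔸 G P x) (fun U => U) (GpY x.toKIdx parA) parH).e4 U := rfl
  have e2 : (KSCUPar P G x parA parH C37 C38).h2 (.base U) = (kernelFamilyS x.toKIdx (bg9YC 𝔸 G P x) (fun U => U) (GpY x.toKIdx parA) parH).h2 U := rfl
  rw [e1, e4, e2]
  exact hnn

variable {ι : Type} [Fintype ι] (b : Module.Basis ι ℝ 𝔸) (ιB : BlkY x.toKIdx → IBondY x.toKIdx) [Fintype (geo9Y x).Site] [FiniteDimensional ℝ 𝔸]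

/-- the (3.42) reading dictionary of `KSC₃Par` is `KSC₃ parA`'s. [cite: Balaban1985BackgroundPropagators, (3.42) p.397; Balaban1984PropagatorsII, (2.51) p.232] -/
theorem read342Y_KSC₃Par (hι : ∀ s : BlkY x.toKIdx, β x.toKIdx.hN x.toKIdx.D x.toKIdx.hk (ιB s) = s)
    (M₂ : ℝ) (hM₂ : 0 ≤ M₂) (hrepr : ∀ (v : 𝔸) (j : ι), |b.repr v j| ≤ M₂ * ‖v‖) (c35 MInv aInv : ℝ) :
    Read342Y P G x parA b ιB C37 C38 (KSC₃Par P G x parA parH C37 C38) c35 (M₂ * ∑ j, ‖b j‖) MInv aInv 0 True :=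
  fun α₀ U B₀ δ hM hα₀ hMa hreg hB₀ hδ hE =>
    read342Y_KSC₃ P G x parA C37 C38 b ιB hι M₂ hM₂ hrepr c35 MInv aInv α₀ U B₀ δ hM hα₀ hMa hreg hB₀ hδ ((eBlock_KSC₃Par_iff P G x parA parH C37 C38 _).1 hE)

omit [FiniteDimensional ℝ 𝔸] in
/-- the (3.42) writing dictionary of `KSC₃Par` is `KSC₃ parA`'s. [cite: Balaban1985BackgroundPropagators, (3.42) p.397, p.403; Balaban1984PropagatorsII, (2.51) p.232] -/
theorem write342Y_KSC₃Par (hι : ∀ s : BlkY x.toKIdx, β x.toKIdx.hN x.toKIdx.D x.toKIdx.hk (ιB s) = s)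
    (M₂ : ℝ) (hM₂ : 0 ≤ M₂) (hrepr : ∀ (v : 𝔸) (j : ι), |b.repr v j| ≤ M₂ * ‖v‖) (aW : ℝ) (hC37 : ∀ β' U a, C37 β' U a → GVal G x.toKIdx U) :
    Write342Y P G x parA b ιB C37 C38 (KSC₃Par P G x parA parH C37 C38) (fun B _ => (M₂ * ∑ j, ‖b j‖) * B + 1) (fun δ => δ) aW 0 True :=
  fun U a α₁ B δ hα₁ hα₁W h37 hB hδ hG hDG hGD hLG =>
    (eBlock_KSC₃Par_iff P G x parA parH C37 C38 _).2 (write342Y_KSC₃ P G x parA C37 C38 b ιB hι M₂ hM₂ hrepr aW hC37 U a α₁ B δ hα₁ hα₁W h37 hB hδ hG hDG hGD hLG)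

/-! ## §2 The input transport `KSCUPar ⟹ KSC₃Par` at a regular base -/

/-- ★★ **THE `L²` INPUT ESTIMATE AT ONE REGULAR BASE FOR THE TWO-TRANSPORTER READING**: at a `G`-valued `U` above `2(d+1) < M` (neighbourhood count `mN`) carrying
[4] Lemma 2.1 at `(δ₀, 1∕12)` and the scale transfers, and the plaquette law `PlaqLawY c_P U`, the block of `(KSCUPar parA parH, KACU, C)` with `(B₀, δ₀, …)`, `δ₀ > 0`,
gives that of `(KSC₃Par parA parH, KACU, C)` with constant `max (max (c_in·max B₀ 0) 1) B_L`, rate `min δ₀ (δ₀∕2)` and the same Hölder ∕ kernel constants: the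
(3.42)∕(3.47) members by `thms_KSC₇Par_base_of_KSCUPar`, the augmented (3.46) member by `l2Block_KSC₃_base_of_record` AT `parA`, the Hölder members by identity
(antitone in the rate by nonnegativity). [cite: Balaban1985BackgroundPropagators, Thms 3.1–3.3 (3.42)–(3.48) pp.397–399, p.398 (first remark), (3.35) p.396; Balaban1984PropagatorsII, Lemma 2.1 p.234, Prop. 2.6 (2.140)–(2.141) p.247] -/
theorem thms_KSC₃Par_base_of_KSCUPar [DecidableEq ι] [DecidableEq (geo9Y x).Site] (hι : ∀ s : BlkY x.toKIdx, β x.toKIdx.hN x.toKIdx.D x.toKIdx.hk (ιB s) = s)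
    (hG1 : ∀ u : 𝔸ˣ, u ∈ G → ‖(u : 𝔸)‖ ≤ 1) {U : CfgY 𝔸 x.toKIdx} (hU : GVal G x.toKIdx U)
    {M₂ : ℝ} (hM₂ : 0 ≤ M₂) (hrepr : ∀ (v : 𝔸) (j : ι), |b.repr v j| ≤ M₂ * ‖v‖) (hM : 2 * ((d : ℝ) + 1) < (geo9Y x).M)
    {mN : ℕ} (hN : ∀ a : IBondY x.toKIdx, (nbr (geo9Y x) (2 * ((d : ℝ) + 1)) a).card ≤ mN)
    {δ₀ : ℝ} (hδ₀ : 0 < δ₀) {dL : ℕ} (h261 : Ineq261 dL (toB6 (geo9Y x) (0 : ℝ) True) δ₀ (1 / 12)) {Λ : ℝ} (hΛ : 1 ≤ Λ)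
    (hT1 : ScaleTransfer (geo9Y x) δ₀ (1 / 12) Λ (fun a => (geo9Y x).len a))
    (hTi2 : ScaleTransfer (geo9Y x) δ₀ (1 / 12) Λ (fun a => ((geo9Y x).len a)⁻¹ ^ 2))
    {cP : ℝ} (hcP : 0 ≤ cP) (hplaq : PlaqLawY x ιB cP U)
    (dC : ℕ) (Cinv : B9.SiteKernel (geo9Y x) (bg9YC 𝔸 G P x)) {B₀ : ℝ} {Bβ Bε : ℝ → ℝ} {Bεβ : ℝ → ℝ → ℝ} {B₁ δ₁ : ℝ}
    (h : B9.Thms31to33IneqAt dC (KSCUPar P G x parA parH C37 C38) (KACU P G x OA parB C37 C38) (pullS (codingYx P G x C37 C38) Cinv)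
      B₀ δ₀ Bβ Bε Bεβ B₁ δ₁ (.base U)) :
    B9.Thms31to33IneqAt dC (KSC₃Par P G x parA parH C37 C38) (KACU P G x OA parB C37 C38) (pullS (codingYx P G x C37 C38) Cinv)
      (max (max ((((ℓ + 1 : ℕ) : ℝ) * Real.exp (|δ₀| * (2 * ((d : ℝ) + 1))) + ((mN : ℝ) * (M₂ * ∑ j, ‖b j‖) * Real.exp (|δ₀| * (2 * ((d : ℝ) + 1))) + 1))
        * max B₀ 0) 1)
        ((Real.sqrt (Fintype.card ι) * M₂ * ∑ j, ‖b j‖) *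
          max (crossConstL2 M₂ (∑ j, ‖b j‖) (Real.sqrt (Fintype.card ι)) d dL δ₀ Λ (max B₀ 0))
            (cross2ConstL2 cP M₂ (∑ j, ‖b j‖) (Real.sqrt (Fintype.card ι)) d dL δ₀ Λ (max B₀ 0))))
      (min δ₀ (δ₀ / 2)) Bβ Bε Bεβ B₁ δ₁ (.base U) := by
  set cIn : ℝ := ((ℓ + 1 : ℕ) : ℝ) * Real.exp (|δ₀| * (2 * ((d : ℝ) + 1))) + ((mN : ℝ) * (M₂ * ∑ j, ‖b j‖) * Real.exp (|δ₀| * (2 * ((d : ℝ) + 1))) + 1)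
    with hcIn
  set Sb : ℝ := ∑ j, ‖b j‖ with hSb
  set sι : ℝ := Real.sqrt (Fintype.card ι) with hsι
  set BL : ℝ := (sι * M₂ * Sb) * max (crossConstL2 M₂ Sb sι d dL δ₀ Λ (max B₀ 0)) (cross2ConstL2 cP M₂ Sb sι d dL δ₀ Λ (max B₀ 0)) with hBL
  have hSb0 : 0 ≤ Sb := Finset.sum_nonneg fun j _ => norm_nonneg _
  have hsι0 : 0 ≤ sι := Real.sqrt_nonneg _
  have hBL0 : 0 ≤ BL := by
    have := crossConstL2_nonneg hM₂ hSb0 hsι0 d dL δ₀ Λ (le_max_right B₀ 0)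
    rw [hBL]; exact mul_nonneg (by positivity) (le_max_of_le_left this)
  have hB7 : 0 ≤ max (cIn * max B₀ 0) 1 := le_trans zero_le_one (le_max_right _ _)
  have hrate : min δ₀ (δ₀ / 2) ≤ δ₀ := min_le_left _ _
  -- (1) the two-transporter frame family's block at the base (the (3.42)∕(3.47) members and the Hölder block)
  have hK7 := thms_mono_B₀ P G x C37 C38 dC _ _ _ (le_max_left (cIn * max B₀ 0) 1)
    (thms_KSC₇Par_base_of_KSCUPar P G x parA parH OA parB b ιB C37 C38 hι hG1 hU hM₂ hrepr hM hN dC Cinv h)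
  obtain ⟨⟨h42, h43⟩, hC, ⟨g42, g43⟩⟩ := hK7
  -- (2) the record reading's `L²` block at `U` (transporter-blind members of `KSCUPar` = `KSCU parA`'s), and its augmentation for `KSC₃ parA`
  obtain ⟨⟨hT42, -⟩, -, -⟩ := h
  obtain ⟨-, -, bl2, -⟩ := KSCUPar_blind_members P G x parA parH C37 C38
  obtain ⟨-, -, -, -, ul2, -⟩ := KSCU_members_base P G x parA C37 C38 U
  have hL2 : L2Block (kernelFamilyS x.toKIdx (bg9YC 𝔸 G P x) (fun U => U) (GpY x.toKIdx parA) parA) (max B₀ 0) δ₀ U :=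
    l2Block_max_zero x _ fun n lam hh y y' hc hs => by
      have h1 := hT42.2.1 n lam hh y y' hc hs
      rw [bl2, ul2 n] at h1
      exact h1
  have hK3 := l2Block_KSC₃_base_of_record P G x parA b ιB C37 C38 hι hG1 hM₂ hrepr hδ₀ h261 hΛ hT1 hTi2 hcP (le_max_right B₀ 0) hU hplaq hL2
  have hK3' : L2Block (KSC₃Par P G x parA parH C37 C38) BL (δ₀ / 2) (.base U) := by
    rw [l2Block_KSC₃Par_iff, hBL, hSb, hsι]; exact hK3
  -- (3) assembly at the constants `(max (max (cIn·max B₀ 0) 1) BL, min δ₀ (δ₀/2))`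
  have h42' := ineq342_346_347_weaken P G x C37 C38 (KSC₇Par P G x parA parH C37 C38) hB7 (le_max_left _ BL) hrate h42
  have hL' := l2Block_weaken x (KSC₃Par P G x parA parH C37 C38) hBL0 (le_max_right (max (cIn * max B₀ 0) 1) BL) (min_le_right δ₀ (δ₀ / 2)) hK3'
  obtain ⟨pe, ph1, pe4, ph2⟩ := KSC₃Par_members₇ P G x parA parH C37 C38
  obtain ⟨-, -, -, -, -, pglob⟩ := KSC₃Par_members P G x parA parH C37 C38
  obtain ⟨nn1, nn4, nn2⟩ := KSCUPar_holder_nonneg_base P G x parA parH C37 C38 U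
  obtain ⟨-, qh1, qe4, qh2, -, -⟩ := KSC₃Par_members P G x parA parH C37 C38
  have hP1 : ∀ lam β' ζ, 0 ≤ (KSC₃Par P G x parA parH C37 C38).h1 (.base U) lam β' ζ := fun lam β' ζ => by rw [congrFun qh1 _]; exact nn1 lam β' ζ
  have hP4 : ∀ lam y, 0 ≤ (KSC₃Par P G x parA parH C37 C38).e4 (.base U) lam y := fun lam y => by rw [congrFun qe4 _]; exact nn4 lam y
  have hP2 : ∀ lam β' ζ, 0 ≤ (KSC₃Par P G x parA parH C37 C38).h2 (.base U) lam β' ζ := fun lam β' ζ => by rw [congrFun qh2 _]; exact nn2 lam β' ζ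
  obtain ⟨an1, an4, an2⟩ := KACU_holder_nonneg P G x OA parB C37 C38 (.base U)
  refine ⟨⟨⟨fun n lam y y' hs => ?_, fun n lam hh y y' hc hs => hL' n lam hh y y' hc hs, fun n lam γ h4 h4' => ?_⟩, ?_⟩, hC,
    ⟨ineq342_346_347_weaken P G x C37 C38 _ hB7 (le_max_left _ BL) hrate g42, ineq343_345_antitone P G x C37 C38 _ an1 an4 an2 hrate Bβ Bε Bεβ g43⟩⟩
  · rw [congrFun (congrFun pe n) _]; exact h42'.1 n lam y y' hs
  · -- the (3.47) member of `KSC₃Par` at a base is `KSC₂ parA`'s = `KSC parA`'s = `KSC₇Par`'s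
    rw [congrFun (congrFun pglob n) _]
    show (KSC P G x parA C37 C38).glob n (.base U) lam γ ≤ _
    exact h42'.2.2 n lam γ h4 h4'
  · exact ineq343_345_antitone P G x C37 C38 _ hP1 hP4 hP2 hrate Bβ Bε Bεβ
      (ineq343_345_congr P G x C37 C38 _ _ (congrFun ph1 _).symm (congrFun pe4 _).symm (congrFun ph2 _).symm Bβ Bε Bεβ δ₀ h43)

end Family

/-! ## §2b The input transport with positive constants, on a subfamily -/

section Steps

variable [NormOneClass 𝔸] [FiniteDimensional ℝ 𝔸] {J : Type} (f : J → MemberY d ℓ hd hL b₀ b₁ Mstar)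
  (c35 : ℝ) (G : Subgroup 𝔸ˣ) {ι : Type} [Fintype ι] [DecidableEq ι] (b : Module.Basis ι ℝ 𝔸)
  [∀ x : MemberY d ℓ hd hL b₀ b₁ Mstar, Fintype (geo9Y x).Site] [∀ x : MemberY d ℓ hd hL b₀ b₁ Mstar, DecidableEq (geo9Y x).Site]
  [∀ x : MemberY d ℓ hd hL b₀ b₁ Mstar, Nonempty (geo9Y x).Site]
  (C37 C38 : ∀ j : J, ℝ → CfgY 𝔸 (f j).toKIdx → AfldY 𝔸 (f j).toKIdx → Prop)
  (parA parH : ∀ j : J, SiteParY 𝔸 (f j).toKIdx) (OA : ∀ j : J, BondOpY 𝔸 (f j).toKIdx) (parB : ∀ j : J, BondParY 𝔸 (f j).toKIdx)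
  (ιB : ∀ j : J, BlkY (f j).toKIdx → IBondY (f j).toKIdx)
  (Cinv : ∀ j : J, B9.SiteKernel (geo9Y (f j)) (bg9YC 𝔸 G P (f j)))

omit [NormOneClass 𝔸] [∀ x : MemberY d ℓ hd hL b₀ b₁ Mstar, Nonempty (geo9Y x).Site] in
/-- ★★ **`hin` FOR THE `L²` STEP OF THE TWO-TRANSPORTER READING WITH POSITIVE OUTPUT CONSTANTS** (input families `(KSCUPar parA parH, KACU, pullS C⁻¹)`; output
`KSC₃Par parA parH` with the shared `KACU`, `pullS C⁻¹`): thresholds `max (max (max ML (2(d+1)+1)) (Mthr δ₀)) MIp`, cap `min 1 aIp`; §2's estimate at every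
regular base; displayed: the GUARDED plaquette law `hplaq` (asked only at `M ≥ MIp`, `0 < α₀`, `M·α₀ ≤ aIp` — the shape of record, `B9SectBStepUGuardedR`). [cite: Balaban1985BackgroundPropagators, Thms 3.1–3.3 (3.42)–(3.48) pp.397–399, (3.35) p.396, p.398 (first remark), p.404 (after (3.69)); Balaban1984PropagatorsII, Lemma 2.1 p.234] -/
theorem hin_KSCUPar₃_on_pos (hι : ∀ (j : J) (s : BlkY (f j).toKIdx), β (f j).toKIdx.hN (f j).toKIdx.D (f j).toKIdx.hk (ιB j s) = s)
    (hG1 : ∀ u : 𝔸ˣ, u ∈ G → ‖(u : 𝔸)‖ ≤ 1) {M₂ : ℝ} (hM₂ : 0 ≤ M₂) (hrepr : ∀ (v : 𝔸) (j : ι), |b.repr v j| ≤ M₂ * ‖v‖) (dC : ℕ)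
    {cP : ℝ} (hcP : 0 ≤ cP) {MIp aIp : ℝ} (haIp : 0 < aIp)
    (hplaq : ∀ (j : J) (α₀ : ℝ) (U : CfgY 𝔸 (f j).toKIdx), MIp ≤ (geo9Y (f j)).M → 0 < α₀ → (geo9Y (f j)).M * α₀ ≤ aIp →
      (bg9YC 𝔸 G P (f j)).Reg335 c35 α₀ U → PlaqLawY (f j) (ιB j) cP U) :
    ∀ (B₀ δ₀ : ℝ) (Bβ Bε : ℝ → ℝ) (Bεβ : ℝ → ℝ → ℝ) (B₁ δ₁ : ℝ), 0 < B₀ → 0 < δ₀ → 0 < B₁ → 0 < δ₁ →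
      ∃ (Mi ai B₀' δ₀' : ℝ) (Bβ' Bε' : ℝ → ℝ) (Bεβ' : ℝ → ℝ → ℝ) (B₁' δ₁' : ℝ), 0 < ai ∧ 0 < B₀' ∧ 0 < δ₀' ∧ 0 < B₁' ∧ 0 < δ₁' ∧
        ∀ j : J, Mi ≤ (geo9Y (f j)).M → ∀ α₀ : ℝ, 0 < α₀ → (geo9Y (f j)).M * α₀ ≤ ai →
          ∀ c : (codingYx P G (f j) (C37 j) (C38 j)).bg.Cfg, (codingYx P G (f j) (C37 j) (C38 j)).bg.Reg335 c35 α₀ c →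
          B9.Thms31to33IneqAt dC (KSCUPar P G (f j) (parA j) (parH j) (C37 j) (C38 j)) (KACU P G (f j) (OA j) (parB j) (C37 j) (C38 j))
              (pullS (codingYx P G (f j) (C37 j) (C38 j)) (Cinv j)) B₀ δ₀ Bβ Bε Bεβ B₁ δ₁ c →
          B9.Thms31to33IneqAt dC (KSC₃Par P G (f j) (parA j) (parH j) (C37 j) (C38 j)) (KACU P G (f j) (OA j) (parB j) (C37 j) (C38 j))
              (pullS (codingYx P G (f j) (C37 j) (C38 j)) (Cinv j)) B₀' δ₀' Bβ' Bε' Bεβ' B₁' δ₁' c := by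
  intro B₀ δ₀ Bβ Bε Bεβ B₁ δ₁ hB₀ hδ₀ hB₁ hδ₁
  obtain ⟨ML, mN, hcnt⟩ := exists_card_nbr_geo9Y_le_of_M (d := d) (ℓ := ℓ) (hd := hd) (hL := hL) (b₀ := b₀) (b₁ := b₁) (2 * ((d : ℝ) + 1))
  obtain ⟨d261, Mthr, hthr⟩ := exists_thresholds_L2 f
  set cIn : ℝ := ((ℓ + 1 : ℕ) : ℝ) * Real.exp (|δ₀| * (2 * ((d : ℝ) + 1))) + ((mN : ℝ) * (M₂ * ∑ j, ‖b j‖) * Real.exp (|δ₀| * (2 * ((d : ℝ) + 1))) + 1)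
    with hcIn
  set Sb : ℝ := ∑ j, ‖b j‖ with hSb
  set sι : ℝ := Real.sqrt (Fintype.card ι) with hsι
  set Λ : ℝ := ((ℓ : ℝ) + 1) ^ 4 with hΛ
  set BL : ℝ := (sι * M₂ * Sb) * max (crossConstL2 M₂ Sb sι d (d261 δ₀) δ₀ Λ (max B₀ 0)) (cross2ConstL2 cP M₂ Sb sι d (d261 δ₀) δ₀ Λ (max B₀ 0))
    with hBL
  have hΛ1 : 1 ≤ Λ := one_le_pow₀ (by linarith [(Nat.cast_nonneg ℓ : (0 : ℝ) ≤ ℓ)])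
  refine ⟨max (max (max ML (2 * ((d : ℝ) + 1) + 1)) (Mthr δ₀)) MIp, min 1 aIp, max (max (cIn * max B₀ 0) 1) BL, min δ₀ (δ₀ / 2), Bβ, Bε, Bεβ, B₁, δ₁,
    lt_min one_pos haIp, lt_max_of_lt_left (lt_max_of_lt_right one_pos), lt_min hδ₀ (half_pos hδ₀), hB₁, hδ₁, fun j hM' α₀ hα₀ hMa' c hreg hT => ?_⟩
  have hM : max (max ML (2 * ((d : ℝ) + 1) + 1)) (Mthr δ₀) ≤ (geo9Y (f j)).M := le_trans (le_max_left _ _) hM'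
  have hMI : MIp ≤ (geo9Y (f j)).M := le_trans (le_max_right _ _) hM'
  have hMaI : (geo9Y (f j)).M * α₀ ≤ aIp := hMa'.trans (min_le_right _ _)
  obtain ⟨U, rfl, hU335⟩ := (codingYx P G (f j) (C37 j) (C38 j)).exists_of_bg_Reg335 hreg
  have hU : GVal G (f j).toKIdx U := hU335.1.1
  have hM2 : 2 * ((d : ℝ) + 1) < (geo9Y (f j)).M := by
    have := le_trans (le_max_right _ _) (le_trans (le_max_left _ _) hM); linarith
  have hML : ML ≤ (geo9Y (f j)).M := le_trans (le_max_left _ _) (le_trans (le_max_left _ _) hM)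
  have hMt : Mthr δ₀ ≤ (geo9Y (f j)).M := le_trans (le_max_right _ _) hM
  obtain ⟨h261, hT1, -, -, hTi2⟩ := hthr j δ₀ hδ₀ hMt
  have h := thms_KSC₃Par_base_of_KSCUPar P G (f j) (parA j) (parH j) (OA j) (parB j) (C37 j) (C38 j) b (ιB j) (hι j) hG1 hU hM₂ hrepr hM2
    (fun a => hcnt Mstar (f j) hML a) hδ₀ h261 hΛ1 hT1 hTi2 hcP (hplaq j α₀ U hMI hα₀ hMaI hU335) dC (Cinv j) hT
  rw [hBL, hSb, hsι]
  exact h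

/-! ## §3 The `L²` frame AT `KSC₃Par` and its six block-steps -/

/-- ★ **THE `L²` FRAME OVER THE CODED CARRIERS OF A SUBFAMILY AT `KSC₃Par parA parH`** (dag-n06-c g9's `B9SectBL2DictionaryY.l2Frame₂CodedOn` re-keyed: the root
frame `gpFrame₂CodedOn` at `parA` with the laws `hpar hunit hC37` at `parA`, the (3.42) dictionaries `read342Y ∕ write342Y_KSC₃Par`, the `L²` constant
`c_L = √|ι|·M₂·Σ‖b_j‖`, and the `L²` read∕write dictionaries of `KSC₃ parA` (`readL2_KSC₃`, `writeL2_zero ∕ one_KSC₃`) bridged by `l2Block_KSC₃Par_iff` and the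
definitional equality of the `l2` members). [cite: Balaban1985BackgroundPropagators, Thm 3.1 (3.46) p.398, Thm 3.4 p.400, p.403 l.1–9; Balaban1984PropagatorsII, Prop. 2.6 (2.140)–(2.141) p.247, (2.51) p.232] -/
noncomputable def l2Frame₂CodedOnPar (hι : ∀ (j : J) (s : BlkY (f j).toKIdx), β (f j).toKIdx.hN (f j).toKIdx.D (f j).toKIdx.hk (ιB j s) = s)
    (hG1 : ∀ u : 𝔸ˣ, u ∈ G → ‖(u : 𝔸)‖ ≤ 1) (hpar : ∀ j (U : CfgY 𝔸 (f j).toKIdx), GVal G (f j).toKIdx U → ∀ z w, parA j U z w ∈ G)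
    (hunit : ∀ j (U : CfgY 𝔸 (f j).toKIdx), GVal G (f j).toKIdx U → IsUnit (Node00.deltaPrimeAY (f j).toKIdx (parA j) U))
    (dB : ℕ) (M₂ : ℝ) (hM₂ : 0 ≤ M₂) (hrepr : ∀ (v : 𝔸) (j : ι), |b.repr v j| ≤ M₂ * ‖v‖) (hcR : 0 < M₂ * ∑ j, ‖b j‖)
    (hcL : 0 < Real.sqrt (Fintype.card ι) * M₂ * ∑ j, ‖b j‖)
    (Cq : ℝ) (hCq : 0 ≤ Cq) (hC37 : ∀ j β' U a, C37 j β' U a → GVal G (f j).toKIdx U ∧ CplxLettersY G (f j) (parA j) (ιB j) Cq β' U a)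
    (MInv aInv aW : ℝ) (hMInv : 0 < MInv) (haInv : 0 < aInv) (haW : 0 < aW) :
    B9SectBL2StepAtLettersV2.L2Frame₂ c35 (fun j => geo9Y (f j)) (fun j => (codingYx P G (f j) (C37 j) (C38 j)).bg)
      (fun j => KSC₃Par P G (f j) (parA j) (parH j) (C37 j) (C38 j)) b (Fin (d + 1)) (fun j => SiteY (f j).toKIdx) :=
  { B9SectBCodedChainOnSubfamilyR.gpFrame₂CodedOn P f c35 G b C37 C38 parA ιB (fun j => KSC₃Par P G (f j) (parA j) (parH j) (C37 j) (C38 j)) hι hG1 hpar hunit dB M₂ hM₂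
      hrepr Cq hCq hC37 (M₂ * ∑ j, ‖b j‖) hcR (fun B _ => (M₂ * ∑ j, ‖b j‖) * B + 1) (fun B _ hB _ => by positivity) (fun δ => δ) (fun δ hδ => hδ)
      MInv aInv aW hMInv haInv haW (fun j => read342Y_KSC₃Par P G (f j) (parA j) (parH j) (C37 j) (C38 j) b (ιB j) (hι j) M₂ hM₂ hrepr c35 MInv aInv)
      (fun j => write342Y_KSC₃Par P G (f j) (parA j) (parH j) (C37 j) (C38 j) b (ιB j) (hι j) M₂ hM₂ hrepr aW fun β' U a h => (hC37 j β' U a h).1) with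
    cL := Real.sqrt (Fintype.card ι) * M₂ * ∑ j, ‖b j‖
    wL := fun B _ => (Real.sqrt (Fintype.card ι) * M₂ * ∑ j, ‖b j‖) * B + 1
    wLδ := fun δ => δ
    cL_pos := hcL
    wL_pos := fun B _ hB _ => by positivity
    wLδ_pos := fun δ hδ => hδ
    readL2 := fun j α₀ c B₀ δ _ _ _ hreg hB₀ _ hL2 => by
      obtain ⟨U, rfl, hU⟩ := (codingYx P G (f j) (C37 j) (C38 j)).exists_of_bg_Reg335 hreg
      exact readL2_KSC₃ P G (f j) (parA j) (C37 j) (C38 j) b (ιB j) (hι j) hM₂ hrepr hU.1.1 hB₀.le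
        ((l2Block_KSC₃Par_iff P G (f j) (parA j) (parH j) (C37 j) (C38 j) _).1 hL2)
    writeL2_0 := fun j c c' α₁ B δ _ _ h37 hB _ hG lam h y y' hc hs => by
      obtain ⟨U, a, rfl, rfl, hC⟩ := (codingYx P G (f j) (C37 j) (C38 j)).exists_of_bg_Cplx337 h37
      exact writeL2_zero_KSC₃ P G (f j) (parA j) (C37 j) (C38 j) b (ιB j) (hι j) hM₂ hrepr U a hB hG lam h y y' hc hs
    writeL2_1 := fun j c c' α₁ B δ _ _ h37 hB _ hDG lam h y y' hc hs => by
      obtain ⟨U, a, rfl, rfl, hC⟩ := (codingYx P G (f j) (C37 j) (C38 j)).exists_of_bg_Cplx337 h37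
      exact writeL2_one_KSC₃ P G (f j) (parA j) (C37 j) (C38 j) b (ιB j) (hι j) hM₂ hrepr (hC37 j _ U a hC).1 a hB hDG lam h y y' hc hs }

/-- ★★ **THE POSITIVE-INPUT (3.46) BLOCK-STEP OF THE TWO-TRANSPORTER `L²` FRAME FAMILY `KSC₃Par parA parH`, MEMBER BY MEMBER, ON A SUBFAMILY** (all six members), from the letters-level frames over the
coded carrier (`l2Frame₂CodedOn`) and the six tautological read/write fields of the augmented readings; any `GA`, `Cinv`.
[cite: Balaban1985BackgroundPropagators, Thm 3.1 (3.46) p.398, Thm 3.4 p.400, (3.63)–(3.67) pp.402–403, p.403 l.1–9; Balaban1984PropagatorsII, Prop. 2.6 (2.140)–(2.141) p.247, Lemma 2.1 p.234] -/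
theorem stepL2nPos_KSC₃Par_on (hι : ∀ (j : J) (s : BlkY (f j).toKIdx), β (f j).toKIdx.hN (f j).toKIdx.D (f j).toKIdx.hk (ιB j s) = s)
    (hG1 : ∀ u : 𝔸ˣ, u ∈ G → ‖(u : 𝔸)‖ ≤ 1) (hpar : ∀ j (U : CfgY 𝔸 (f j).toKIdx), GVal G (f j).toKIdx U → ∀ z w, parA j U z w ∈ G)
    (hunit : ∀ j (U : CfgY 𝔸 (f j).toKIdx), GVal G (f j).toKIdx U → IsUnit (Node00.deltaPrimeAY (f j).toKIdx (parA j) U))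
    (dB : ℕ) (M₂ : ℝ) (hM₂ : 0 ≤ M₂) (hrepr : ∀ (v : 𝔸) (j : ι), |b.repr v j| ≤ M₂ * ‖v‖) (hcR : 0 < M₂ * ∑ j, ‖b j‖)
    (hcL : 0 < Real.sqrt (Fintype.card ι) * M₂ * ∑ j, ‖b j‖)
    (Cq : ℝ) (hCq : 0 ≤ Cq) (hC37 : ∀ j β' U a, C37 j β' U a → GVal G (f j).toKIdx U ∧ CplxLettersY G (f j) (parA j) (ιB j) Cq β' U a)
    (MInv aInv aW : ℝ) (hMInv : 0 < MInv) (haInv : 0 < aInv) (haW : 0 < aW)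
    (GA : ∀ j : J, B9.KernelFamily (geo9Y (f j)) (codingYx P G (f j) (C37 j) (C38 j)).bg)
    (Cinv : ∀ j : J, B9.SiteKernel (geo9Y (f j)) (codingYx P G (f j) (C37 j) (C38 j)).bg) (n : Fin 6) :
    StepL2nPos dB c35 (fun j => geo9Y (f j)) (fun j => (codingYx P G (f j) (C37 j) (C38 j)).bg) (fun j => KSC₃Par P G (f j) (parA j) (parH j) (C37 j) (C38 j)) GA Cinv
      (fun j => KSC₃Par P G (f j) (parA j) (parH j) (C37 j) (C38 j)) n := by
  set F := l2Frame₂CodedOnPar P f c35 G b C37 C38 parA parH ιB hι hG1 hpar hunit dB M₂ hM₂ hrepr hcR hcL Cq hCq hC37 MInv aInv aW hMInv haInv haW with hF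
  -- the six tautological fields of the augmented readings, in the frames' binder shapes
  have r2 : ∀ j (α₀ : ℝ) (c : (codingYx P G (f j) (C37 j) (C38 j)).bg.Cfg) (B₀ δ : ℝ), F.MInv ≤ (geo9Y (f j)).M → 0 < α₀ → (geo9Y (f j)).M * α₀ ≤ F.aInv →
      (codingYx P G (f j) (C37 j) (C38 j)).bg.Reg335 c35 α₀ c → 0 < B₀ → 0 < δ → B9FromB6.L2Block (KSC₃Par P G (f j) (parA j) (parH j) (C37 j) (C38 j)) B₀ δ c →
      ∀ k : Fin (d + 1) ⊕ Fin (d + 1), B6RandomWalkL2.HasL2Majorant (g := B9Thm34Ext.toB6 (geo9Y (f j)) (F.Rr j) (F.Hp j))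
        (fun p : SiteY (f j).toKIdx × ι => F.blk j p.1)
        (F.Gop j c * B9Eq352DivFormLetters.conj b (B9Eq352GradLetters.diffLetter (F.T j) (F.coord j c) ((((geo9Y (f j)).eta : ℂ))⁻¹) k))
        (fun a a' => F.cL * B₀ * (geo9Y (f j)).len a * Real.exp (-(δ * (geo9Y (f j)).dist a a'))) := by
    intro j α₀ c B₀ δ _ _ _ hreg hB₀ _ hL2 k
    obtain ⟨U, rfl, hU⟩ := (codingYx P G (f j) (C37 j) (C38 j)).exists_of_bg_Reg335 hreg
    exact readL2_two_KSC₃ P G (f j) (parA j) (C37 j) (C38 j) b (ιB j) (hι j) hM₂ hrepr hU.1.1 hB₀.le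
      ((l2Block_KSC₃Par_iff P G (f j) (parA j) (parH j) (C37 j) (C38 j) _).1 hL2) k
  have r3 : ∀ j (α₀ : ℝ) (c : (codingYx P G (f j) (C37 j) (C38 j)).bg.Cfg) (B₀ δ : ℝ), F.MInv ≤ (geo9Y (f j)).M → 0 < α₀ → (geo9Y (f j)).M * α₀ ≤ F.aInv →
      (codingYx P G (f j) (C37 j) (C38 j)).bg.Reg335 c35 α₀ c → 0 < B₀ → 0 < δ → B9FromB6.L2Block (KSC₃Par P G (f j) (parA j) (parH j) (C37 j) (C38 j)) B₀ δ c →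
      ∀ k l : Fin (d + 1) ⊕ Fin (d + 1), B6RandomWalkL2.HasL2Majorant (g := B9Thm34Ext.toB6 (geo9Y (f j)) (F.Rr j) (F.Hp j))
        (fun p : SiteY (f j).toKIdx × ι => F.blk j p.1)
        (B9Eq352DivFormLetters.conj b (B9Eq352GradLetters.diffLetter (F.T j) (F.coord j c) ((((geo9Y (f j)).eta : ℂ))⁻¹) k) *
          B9Eq352DivFormLetters.conj b (B9Eq352GradLetters.diffLetter (F.T j) (F.coord j c) ((((geo9Y (f j)).eta : ℂ))⁻¹) l) * F.Gop j c)
        (fun a a' => F.cL * B₀ * 1 * Real.exp (-(δ * (geo9Y (f j)).dist a a'))) := by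
    intro j α₀ c B₀ δ _ _ _ hreg hB₀ _ hL2 k l
    obtain ⟨U, rfl, hU⟩ := (codingYx P G (f j) (C37 j) (C38 j)).exists_of_bg_Reg335 hreg
    exact readL2_three_KSC₃ P G (f j) (parA j) (C37 j) (C38 j) b (ιB j) (hι j) hM₂ hrepr hU.1.1 hB₀.le
      ((l2Block_KSC₃Par_iff P G (f j) (parA j) (parH j) (C37 j) (C38 j) _).1 hL2) k l
  have r4 : ∀ j (α₀ : ℝ) (c : (codingYx P G (f j) (C37 j) (C38 j)).bg.Cfg) (B₀ δ : ℝ), F.MInv ≤ (geo9Y (f j)).M → 0 < α₀ → (geo9Y (f j)).M * α₀ ≤ F.aInv →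
      (codingYx P G (f j) (C37 j) (C38 j)).bg.Reg335 c35 α₀ c → 0 < B₀ → 0 < δ → B9FromB6.L2Block (KSC₃Par P G (f j) (parA j) (parH j) (C37 j) (C38 j)) B₀ δ c →
      ∀ k l : Fin (d + 1) ⊕ Fin (d + 1), B6RandomWalkL2.HasL2Majorant (g := B9Thm34Ext.toB6 (geo9Y (f j)) (F.Rr j) (F.Hp j))
        (fun p : SiteY (f j).toKIdx × ι => F.blk j p.1)
        (B9Eq352DivFormLetters.conj b (B9Eq352GradLetters.diffLetter (F.T j) (F.coord j c) ((((geo9Y (f j)).eta : ℂ))⁻¹) k) * F.Gop j c *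
          B9Eq352DivFormLetters.conj b (B9Eq352GradLetters.diffLetter (F.T j) (F.coord j c) ((((geo9Y (f j)).eta : ℂ))⁻¹) l))
        (fun a a' => F.cL * B₀ * 1 * Real.exp (-(δ * (geo9Y (f j)).dist a a'))) := by
    intro j α₀ c B₀ δ _ _ _ hreg hB₀ _ hL2 k l
    obtain ⟨U, rfl, hU⟩ := (codingYx P G (f j) (C37 j) (C38 j)).exists_of_bg_Reg335 hreg
    exact readL2_four_KSC₃ P G (f j) (parA j) (C37 j) (C38 j) b (ιB j) (hι j) hM₂ hrepr hU.1.1 hB₀.le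
      ((l2Block_KSC₃Par_iff P G (f j) (parA j) (parH j) (C37 j) (C38 j) _).1 hL2) k l
  have r5 : ∀ j (α₀ : ℝ) (c : (codingYx P G (f j) (C37 j) (C38 j)).bg.Cfg) (B₀ δ : ℝ), F.MInv ≤ (geo9Y (f j)).M → 0 < α₀ → (geo9Y (f j)).M * α₀ ≤ F.aInv →
      (codingYx P G (f j) (C37 j) (C38 j)).bg.Reg335 c35 α₀ c → 0 < B₀ → 0 < δ → B9FromB6.L2Block (KSC₃Par P G (f j) (parA j) (parH j) (C37 j) (C38 j)) B₀ δ c →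
      ∀ k l : Fin (d + 1) ⊕ Fin (d + 1), B6RandomWalkL2.HasL2Majorant (g := B9Thm34Ext.toB6 (geo9Y (f j)) (F.Rr j) (F.Hp j))
        (fun p : SiteY (f j).toKIdx × ι => F.blk j p.1)
        (F.Gop j c * B9Eq352DivFormLetters.conj b (B9Eq352GradLetters.diffLetter (F.T j) (F.coord j c) ((((geo9Y (f j)).eta : ℂ))⁻¹) k) *
          B9Eq352DivFormLetters.conj b (B9Eq352GradLetters.diffLetter (F.T j) (F.coord j c) ((((geo9Y (f j)).eta : ℂ))⁻¹) l))
        (fun a a' => F.cL * B₀ * 1 * Real.exp (-(δ * (geo9Y (f j)).dist a a'))) := by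
    intro j α₀ c B₀ δ _ _ _ hreg hB₀ _ hL2 k l
    obtain ⟨U, rfl, hU⟩ := (codingYx P G (f j) (C37 j) (C38 j)).exists_of_bg_Reg335 hreg
    exact readL2_five_KSC₃ P G (f j) (parA j) (C37 j) (C38 j) b (ιB j) (hι j) hM₂ hrepr hU.1.1 hB₀.le
      ((l2Block_KSC₃Par_iff P G (f j) (parA j) (parH j) (C37 j) (C38 j) _).1 hL2) k l
  have w2 : ∀ j (c c' : (codingYx P G (f j) (C37 j) (C38 j)).bg.Cfg) (α₁ B δ : ℝ), 0 < α₁ → α₁ ≤ F.aW →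
      (codingYx P G (f j) (C37 j) (C38 j)).bg.Cplx337 α₁ c c' → 0 ≤ B → 0 < δ →
      (∀ k : Fin (d + 1) ⊕ Fin (d + 1), B6RandomWalkL2.HasL2Majorant (g := B9Thm34Ext.toB6 (geo9Y (f j)) (F.Rr j) (F.Hp j))
          (fun p : SiteY (f j).toKIdx × ι => F.blk j p.1)
          (F.Gop j ((codingYx P G (f j) (C37 j) (C38 j)).bg.mul c' c) *
            B9Eq352DivFormLetters.conj b (B9Eq352GradLetters.diffLetter (F.T j) (F.coord j c) ((((geo9Y (f j)).eta : ℂ))⁻¹) k))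
          (fun a a' => B * (geo9Y (f j)).len a * Real.exp (-(δ * (geo9Y (f j)).dist a a')))) →
      ∀ (lam : (geo9Y (f j)).Loc) (h : (geo9Y (f j)).Cut) (y y' : (geo9Y (f j)).Site), (geo9Y (f j)).cutIn h y → (geo9Y (f j)).suppIn lam y' →
        (KSC₃Par P G (f j) (parA j) (parH j) (C37 j) (C38 j)).l2 2 ((codingYx P G (f j) (C37 j) (C38 j)).bg.mul c' c) lam h ≤
          F.wL B δ * B9.pref6 ((geo9Y (f j)).len y) 2 * (geo9Y (f j)).cutSup h * Real.exp (-(F.wLδ δ * (geo9Y (f j)).dist y y')) *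
            (geo9Y (f j)).l2Norm lam := by
    intro j c c' α₁ B δ _ _ h37 hB _ hG lam h y y' hc hs
    obtain ⟨U, a, rfl, rfl, hC⟩ := (codingYx P G (f j) (C37 j) (C38 j)).exists_of_bg_Cplx337 h37
    exact writeL2_two_KSC₃ P G (f j) (parA j) (C37 j) (C38 j) b (ιB j) (hι j) hM₂ hrepr (hC37 j _ U a hC).1 a hB hG lam h y y' hc hs
  have w3 : ∀ j (c c' : (codingYx P G (f j) (C37 j) (C38 j)).bg.Cfg) (α₁ B δ : ℝ), 0 < α₁ → α₁ ≤ F.aW →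
      (codingYx P G (f j) (C37 j) (C38 j)).bg.Cplx337 α₁ c c' → 0 ≤ B → 0 < δ →
      (∀ k l : Fin (d + 1) ⊕ Fin (d + 1), B6RandomWalkL2.HasL2Majorant (g := B9Thm34Ext.toB6 (geo9Y (f j)) (F.Rr j) (F.Hp j))
          (fun p : SiteY (f j).toKIdx × ι => F.blk j p.1)
          (B9Eq352DivFormLetters.conj b (B9Eq352GradLetters.diffLetter (F.T j) (F.coord j c) ((((geo9Y (f j)).eta : ℂ))⁻¹) k) *
            B9Eq352DivFormLetters.conj b (B9Eq352GradLetters.diffLetter (F.T j) (F.coord j c) ((((geo9Y (f j)).eta : ℂ))⁻¹) l) *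
            F.Gop j ((codingYx P G (f j) (C37 j) (C38 j)).bg.mul c' c))
          (fun a a' => B * 1 * Real.exp (-(δ * (geo9Y (f j)).dist a a')))) →
      ∀ (lam : (geo9Y (f j)).Loc) (h : (geo9Y (f j)).Cut) (y y' : (geo9Y (f j)).Site), (geo9Y (f j)).cutIn h y → (geo9Y (f j)).suppIn lam y' →
        (KSC₃Par P G (f j) (parA j) (parH j) (C37 j) (C38 j)).l2 3 ((codingYx P G (f j) (C37 j) (C38 j)).bg.mul c' c) lam h ≤
          F.wL B δ * B9.pref6 ((geo9Y (f j)).len y) 3 * (geo9Y (f j)).cutSup h * Real.exp (-(F.wLδ δ * (geo9Y (f j)).dist y y')) *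
            (geo9Y (f j)).l2Norm lam := by
    intro j c c' α₁ B δ _ _ h37 hB _ hG lam h y y' hc hs
    obtain ⟨U, a, rfl, rfl, hC⟩ := (codingYx P G (f j) (C37 j) (C38 j)).exists_of_bg_Cplx337 h37
    exact writeL2_three_KSC₃ P G (f j) (parA j) (C37 j) (C38 j) b (ιB j) (hι j) hM₂ hrepr (hC37 j _ U a hC).1 a hB hG lam h y y' hc hs
  have w4 : ∀ j (c c' : (codingYx P G (f j) (C37 j) (C38 j)).bg.Cfg) (α₁ B δ : ℝ), 0 < α₁ → α₁ ≤ F.aW →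
      (codingYx P G (f j) (C37 j) (C38 j)).bg.Cplx337 α₁ c c' → 0 ≤ B → 0 < δ →
      (∀ k l : Fin (d + 1) ⊕ Fin (d + 1), B6RandomWalkL2.HasL2Majorant (g := B9Thm34Ext.toB6 (geo9Y (f j)) (F.Rr j) (F.Hp j))
          (fun p : SiteY (f j).toKIdx × ι => F.blk j p.1)
          (B9Eq352DivFormLetters.conj b (B9Eq352GradLetters.diffLetter (F.T j) (F.coord j c) ((((geo9Y (f j)).eta : ℂ))⁻¹) k) *
            F.Gop j ((codingYx P G (f j) (C37 j) (C38 j)).bg.mul c' c) *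
            B9Eq352DivFormLetters.conj b (B9Eq352GradLetters.diffLetter (F.T j) (F.coord j c) ((((geo9Y (f j)).eta : ℂ))⁻¹) l))
          (fun a a' => B * 1 * Real.exp (-(δ * (geo9Y (f j)).dist a a')))) →
      ∀ (lam : (geo9Y (f j)).Loc) (h : (geo9Y (f j)).Cut) (y y' : (geo9Y (f j)).Site), (geo9Y (f j)).cutIn h y → (geo9Y (f j)).suppIn lam y' →
        (KSC₃Par P G (f j) (parA j) (parH j) (C37 j) (C38 j)).l2 4 ((codingYx P G (f j) (C37 j) (C38 j)).bg.mul c' c) lam h ≤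
          F.wL B δ * B9.pref6 ((geo9Y (f j)).len y) 4 * (geo9Y (f j)).cutSup h * Real.exp (-(F.wLδ δ * (geo9Y (f j)).dist y y')) *
            (geo9Y (f j)).l2Norm lam := by
    intro j c c' α₁ B δ _ _ h37 hB _ hG lam h y y' hc hs
    obtain ⟨U, a, rfl, rfl, hC⟩ := (codingYx P G (f j) (C37 j) (C38 j)).exists_of_bg_Cplx337 h37
    exact writeL2_four_KSC₃ P G (f j) (parA j) (C37 j) (C38 j) b (ιB j) (hι j) hM₂ hrepr (hC37 j _ U a hC).1 a hB hG lam h y y' hc hs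
  have w5 : ∀ j (c c' : (codingYx P G (f j) (C37 j) (C38 j)).bg.Cfg) (α₁ B δ : ℝ), 0 < α₁ → α₁ ≤ F.aW →
      (codingYx P G (f j) (C37 j) (C38 j)).bg.Cplx337 α₁ c c' → 0 ≤ B → 0 < δ →
      (∀ k l : Fin (d + 1) ⊕ Fin (d + 1), B6RandomWalkL2.HasL2Majorant (g := B9Thm34Ext.toB6 (geo9Y (f j)) (F.Rr j) (F.Hp j))
          (fun p : SiteY (f j).toKIdx × ι => F.blk j p.1)
          (F.Gop j ((codingYx P G (f j) (C37 j) (C38 j)).bg.mul c' c) *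
            B9Eq352DivFormLetters.conj b (B9Eq352GradLetters.diffLetter (F.T j) (F.coord j c) ((((geo9Y (f j)).eta : ℂ))⁻¹) k) *
            B9Eq352DivFormLetters.conj b (B9Eq352GradLetters.diffLetter (F.T j) (F.coord j c) ((((geo9Y (f j)).eta : ℂ))⁻¹) l))
          (fun a a' => B * 1 * Real.exp (-(δ * (geo9Y (f j)).dist a a')))) →
      ∀ (lam : (geo9Y (f j)).Loc) (h : (geo9Y (f j)).Cut) (y y' : (geo9Y (f j)).Site), (geo9Y (f j)).cutIn h y → (geo9Y (f j)).suppIn lam y' →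
        (KSC₃Par P G (f j) (parA j) (parH j) (C37 j) (C38 j)).l2 5 ((codingYx P G (f j) (C37 j) (C38 j)).bg.mul c' c) lam h ≤
          F.wL B δ * B9.pref6 ((geo9Y (f j)).len y) 5 * (geo9Y (f j)).cutSup h * Real.exp (-(F.wLδ δ * (geo9Y (f j)).dist y y')) *
            (geo9Y (f j)).l2Norm lam := by
    intro j c c' α₁ B δ _ _ h37 hB _ hG lam h y y' hc hs
    obtain ⟨U, a, rfl, rfl, hC⟩ := (codingYx P G (f j) (C37 j) (C38 j)).exists_of_bg_Cplx337 h37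
    exact writeL2_five_KSC₃ P G (f j) (parA j) (C37 j) (C38 j) b (ιB j) (hι j) hM₂ hrepr (hC37 j _ U a hC).1 a hB hG lam h y y' hc hs
  match n with
  | 0 => exact B9SectBL2StepAtLettersV2.stepL2nPos_zero_of_l2Frame₂ F GA Cinv
  | 1 => exact B9SectBL2StepAtLettersV2.stepL2nPos_one_of_l2Frame₂ F GA Cinv
  | 2 => exact B9SectBL2StepAtLettersV2Right.stepL2nPos_two_of_l2Frame₂ F r2 w2 GA Cinv
  | 3 => exact B9SectBL2StepAtLettersV2Second.stepL2nPos_three_of_l2Frame₂ F r3 w3 GA Cinv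
  | 4 => exact B9SectBL2StepAtLettersV2Mixed.stepL2nPos_four_of_l2Frame₂ F r2 r4 w4 GA Cinv
  | 5 => exact B9SectBL2StepAtLettersV2Second.stepL2nPos_five_of_l2Frame₂ F r2 r5 w5 GA Cinv

/-- ★★ **THE POSITIVE-INPUT (3.46) BLOCK-STEP `StepL2Pos` OF `KSC₃Par parA parH` ON A SUBFAMILY** (the six members assembled by `B9SectBStepWhole.stepL2Pos_of_members` at
the model signs of the record geometry). [cite: Balaban1985BackgroundPropagators, Thm 3.1 (3.46) p.398, Thm 3.4 p.400, p.403 l.1–9] -/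
theorem stepL2Pos_KSC₃Par_on (hι : ∀ (j : J) (s : BlkY (f j).toKIdx), β (f j).toKIdx.hN (f j).toKIdx.D (f j).toKIdx.hk (ιB j s) = s)
    (hG1 : ∀ u : 𝔸ˣ, u ∈ G → ‖(u : 𝔸)‖ ≤ 1) (hpar : ∀ j (U : CfgY 𝔸 (f j).toKIdx), GVal G (f j).toKIdx U → ∀ z w, parA j U z w ∈ G)
    (hunit : ∀ j (U : CfgY 𝔸 (f j).toKIdx), GVal G (f j).toKIdx U → IsUnit (Node00.deltaPrimeAY (f j).toKIdx (parA j) U))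
    (dB : ℕ) (M₂ : ℝ) (hM₂ : 0 ≤ M₂) (hrepr : ∀ (v : 𝔸) (j : ι), |b.repr v j| ≤ M₂ * ‖v‖) (hcR : 0 < M₂ * ∑ j, ‖b j‖)
    (hcL : 0 < Real.sqrt (Fintype.card ι) * M₂ * ∑ j, ‖b j‖)
    (Cq : ℝ) (hCq : 0 ≤ Cq) (hC37 : ∀ j β' U a, C37 j β' U a → GVal G (f j).toKIdx U ∧ CplxLettersY G (f j) (parA j) (ιB j) Cq β' U a)
    (MInv aInv aW : ℝ) (hMInv : 0 < MInv) (haInv : 0 < aInv) (haW : 0 < aW)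
    (GA : ∀ j : J, B9.KernelFamily (geo9Y (f j)) (codingYx P G (f j) (C37 j) (C38 j)).bg)
    (Cinv : ∀ j : J, B9.SiteKernel (geo9Y (f j)) (codingYx P G (f j) (C37 j) (C38 j)).bg) :
    StepL2Pos dB c35 (fun j => geo9Y (f j)) (fun j => (codingYx P G (f j) (C37 j) (C38 j)).bg) (fun j => KSC₃Par P G (f j) (parA j) (parH j) (C37 j) (C38 j)) GA Cinv
      (fun j => KSC₃Par P G (f j) (parA j) (parH j) (C37 j) (C38 j)) :=
  stepL2Pos_of_members (d := dB) (c35 := c35) (geo := fun j => geo9Y (f j)) (bg := fun j => (codingYx P G (f j) (C37 j) (C38 j)).bg)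
    (Gp := fun j => KSC₃Par P G (f j) (parA j) (parH j) (C37 j) (C38 j)) (GA := GA) (Cinv := Cinv) (fun j => modelSignsOn_geo9K (f j).toKIdx)
    fun n => stepL2nPos_KSC₃Par_on P f c35 G b C37 C38 parA parH ιB hι hG1 hpar hunit dB M₂ hM₂ hrepr hcR hcL Cq hCq hC37 MInv aInv aW hMInv haInv haW GA Cinv n

/-! ## §4 The (3.46) output transport and the member of the Sect.-B step of record -/

omit [∀ x : MemberY d ℓ hd hL b₀ b₁ Mstar, Fintype (geo9Y x).Site] [NormOneClass 𝔸] [DecidableEq ι]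
  [∀ x : MemberY d ℓ hd hL b₀ b₁ Mstar, DecidableEq (geo9Y x).Site] [∀ x : MemberY d ℓ hd hL b₀ b₁ Mstar, Nonempty (geo9Y x).Site] in
/-- ★ **THE (3.46) OUTPUT DOMINATION FOR `KSCUPar`, NO THRESHOLD, SAME CONSTANTS** (input `KSC₃Par`'s = `KSC₃ parA`'s block at the product; output `KSCUPar`'s =
`KSCU parA`'s; `l2Block_KSCU_of_KSC₃` at `parA`). [cite: Balaban1985BackgroundPropagators, Thm 3.1 (3.46) p.398, Thm 3.4 p.400, p.403 l.1–9] -/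
theorem houtL2_KSCUPar_on :
    ∀ (B δ a : ℝ), 0 < B → 0 < δ → 0 < a →
      ∃ (Mo ao a' B' δ' : ℝ), 0 < ao ∧ 0 < a' ∧ a' ≤ a ∧ 0 < B' ∧ 0 < δ' ∧
        ∀ j : J, Mo ≤ (geo9Y (f j)).M → ∀ α₀ : ℝ, 0 < α₀ → (geo9Y (f j)).M * α₀ ≤ ao →
          ∀ c : (codingYx P G (f j) (C37 j) (C38 j)).bg.Cfg, (codingYx P G (f j) (C37 j) (C38 j)).bg.Reg335 c35 α₀ c →
          ∀ α₁ : ℝ, 0 < α₁ → α₁ ≤ a' → ∀ c' : (codingYx P G (f j) (C37 j) (C38 j)).bg.Cfg, (codingYx P G (f j) (C37 j) (C38 j)).bg.Cplx337 α₁ c c' →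
          L2Block (KSC₃Par P G (f j) (parA j) (parH j) (C37 j) (C38 j)) B δ ((codingYx P G (f j) (C37 j) (C38 j)).bg.mul c' c) →
          L2Block (KSCUPar P G (f j) (parA j) (parH j) (C37 j) (C38 j)) B' δ' ((codingYx P G (f j) (C37 j) (C38 j)).bg.mul c' c) :=
  fun B δ a hB hδ ha => ⟨0, 1, a, B, δ, one_pos, ha, le_rfl, hB, hδ, fun j _ _ _ _ _ _ _ _ _ _ _ hL2 => by
    have h := l2Block_KSCU_of_KSC₃ P G (f j) (parA j) (C37 j) (C38 j) ((l2Block_KSC₃Par_iff P G (f j) (parA j) (parH j) (C37 j) (C38 j) _).1 hL2)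
    rw [L2Block, (KSCUPar_blind_members P G (f j) (parA j) (parH j) (C37 j) (C38 j)).2.2.1]
    exact h⟩

/-- ★★★ **`StepL2Pos` OF THE TWO-TRANSPORTER READING OVER THE CODED CARRIER — THE (3.46) MEMBER OF THE SECT.-B STEP OF RECORD FOR `(KSCUPar parA parH, KACU, C⁻¹)`**
(all six (3.46) members; input families `(KSCUPar, KACU, pullS C⁻¹)`): `stepL2Pos_KSC₃Par_on` (with `GA := KACU`, `Cinv := pullS C⁻¹`) transported by
`stepL2Pos_of_family_pos` — `hin_KSCUPar₃_on_pos`, `houtL2_KSCUPar_on`.  Binders = `B9SectBStepUGuardedR.stepL2Pos_KSCU_on_g`'s with `par ↦ parA` (root-frame laws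
`hpar hunit hC37` at `parA`, `hcL`, the GUARDED plaquette law `hplaq` asked only at `M ≥ MInv`, `0 < α₀`, `M·α₀ ≤ aInv`); NO law of the Hölder transporter `parH`.
[cite: Balaban1985BackgroundPropagators, Thm 3.1 (3.46) p.398, Thm 3.4 p.400, (3.63)–(3.67) pp.402–403, p.403 l.1–9, p.404 (after (3.69)); Balaban1984PropagatorsII, Prop. 2.6 (2.140)–(2.141) p.247, Lemma 2.1 p.234] -/
theorem stepL2Pos_KSCUPar_on (hι : ∀ (j : J) (s : BlkY (f j).toKIdx), β (f j).toKIdx.hN (f j).toKIdx.D (f j).toKIdx.hk (ιB j s) = s)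
    (hG1 : ∀ u : 𝔸ˣ, u ∈ G → ‖(u : 𝔸)‖ ≤ 1) (hpar : ∀ j (U : CfgY 𝔸 (f j).toKIdx), GVal G (f j).toKIdx U → ∀ z w, parA j U z w ∈ G)
    (hunit : ∀ j (U : CfgY 𝔸 (f j).toKIdx), GVal G (f j).toKIdx U → IsUnit (Node00.deltaPrimeAY (f j).toKIdx (parA j) U))
    (dB : ℕ) (M₂ : ℝ) (hM₂ : 0 ≤ M₂) (hrepr : ∀ (v : 𝔸) (j : ι), |b.repr v j| ≤ M₂ * ‖v‖) (hcR : 0 < M₂ * ∑ j, ‖b j‖)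
    (hcL : 0 < Real.sqrt (Fintype.card ι) * M₂ * ∑ j, ‖b j‖)
    (Cq : ℝ) (hCq : 0 ≤ Cq) (hC37 : ∀ j β' U a, C37 j β' U a → GVal G (f j).toKIdx U ∧ CplxLettersY G (f j) (parA j) (ιB j) Cq β' U a)
    (MInv aInv aW : ℝ) (hMInv : 0 < MInv) (haInv : 0 < aInv) (haW : 0 < aW) {cP : ℝ} (hcP : 0 ≤ cP)
    (hplaq : ∀ (j : J) (α₀ : ℝ) (U : CfgY 𝔸 (f j).toKIdx), MInv ≤ (geo9Y (f j)).M → 0 < α₀ → (geo9Y (f j)).M * α₀ ≤ aInv →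
      (bg9YC 𝔸 G P (f j)).Reg335 c35 α₀ U → PlaqLawY (f j) (ιB j) cP U) :
    StepL2Pos dB c35 (fun j => geo9Y (f j)) (fun j => (codingYx P G (f j) (C37 j) (C38 j)).bg)
      (fun j => KSCUPar P G (f j) (parA j) (parH j) (C37 j) (C38 j)) (fun j => KACU P G (f j) (OA j) (parB j) (C37 j) (C38 j))
      (fun j => pullS (codingYx P G (f j) (C37 j) (C38 j)) (Cinv j)) (fun j => KSCUPar P G (f j) (parA j) (parH j) (C37 j) (C38 j)) :=
  stepL2Pos_of_family_pos dB c35 (fun j => geo9Y (f j)) (fun j => (codingYx P G (f j) (C37 j) (C38 j)).bg)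
    (fun j => KSC₃Par P G (f j) (parA j) (parH j) (C37 j) (C38 j)) (fun j => KSCUPar P G (f j) (parA j) (parH j) (C37 j) (C38 j))
    (fun j => KACU P G (f j) (OA j) (parB j) (C37 j) (C38 j)) (fun j => KACU P G (f j) (OA j) (parB j) (C37 j) (C38 j))
    (fun j => KSC₃Par P G (f j) (parA j) (parH j) (C37 j) (C38 j)) (fun j => KSCUPar P G (f j) (parA j) (parH j) (C37 j) (C38 j))
    (fun j => pullS (codingYx P G (f j) (C37 j) (C38 j)) (Cinv j))
    (hin_KSCUPar₃_on_pos P f c35 G b C37 C38 parA parH OA parB ιB Cinv hι hG1 hM₂ hrepr dB hcP haInv hplaq)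
    (houtL2_KSCUPar_on P f c35 G C37 C38 parA parH)
    (stepL2Pos_KSC₃Par_on P f c35 G b C37 C38 parA parH ιB hι hG1 hpar hunit dB M₂ hM₂ hrepr hcR hcL Cq hCq hC37 MInv aInv aW hMInv haInv haW _ _)

end Steps

end Literature.MathematicalPhysics.QuantumFieldTheory.Balaban1983to89.B9SectBL2StepUParH

end
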